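/-
Copyright (c) 2026 the pub-hodgecm-mathlib formalisation cell (harness21).  Prover seat hodgecm-mathlib-K2E3-p21 (g5), Track B «K2-LIT» ∕ h413
(`stmt-HodgeConjecture-24833`), line `K2_E3_EllipticInputs`, unit U12 §L, road «GL-[M6]-sc» (line lead K2E3-p23 (g5)); brick T20-GL₃ (C-shell B), FILE 6: «THE BINDER
`HM` OF ★ `ae_setIntegral_conj_eq_inter_of_hcancMixed` (p858539) AND OF `nonEllEstimates_of_hcancMixed` (p858564), VERBATIM, WITH `A = 45`».  2026-09-04.
-/
import Summits.HodgeConjecture.HodgeConjecture.Theorems.K2E3GL3SupercuspOrbitalSliceCancellationNormalForm  -- ★ (C-shell B) FILE 4 (this seat): `…_of_integral_mixed`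
import Literature.NumberTheory.Automorphic.IrreducibleClasses                                           -- ★ `SmoothIrrep`
import HarnessLib

/-!
# K2_E3 road (h413), T20-GL₃ (C-shell B, file 6): the mixed per-point cancellation `HM` in ASM's two frames, `A = 45`

Cell `pub/hodgecm-mathlib` (D-0151), Track B, seat K2E3-p21 (g5).  CONSUMER: K2E3-p23 (g5) — the hypothesis `HM` of ★ `K2E3GL3ModUniformizerNonEllCancellation.
ae_setIntegral_conj_eq_inter_of_hcancMixed` (generic smooth supercuspidal `ρ`) and of `K2E3GL3ModUniformizerNonEllEstimatesOfMixed.nonEllEstimates_of_hcancMixed`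
(`r : SmoothIrrep G'`, no measurable structure on `F` ∕ `GL₃(F)` in the frame), both with the constant `A = 45`: ★ FILE 4
`setIntegral_conj_eq_setIntegral_inter_of_integral_mixed` with `R₀ := 45 s₀ + 13 L₀ + 1 ≤ 45 (s₀ + h + L₀ + 1)`.  `--supports stmt-HodgeConjecture-24833 --as helper`; THEOREMS ONLY.

* **`hcancMixed`** — `∀ g₁ y e h L₀, (mixed normal form, integral, ϖ^h g₁⁻¹ integral, |disc χ_{g₁}| = q^{−L₀}) → ∃ R₀ ≤ 45(s₀+h+L₀+1), ∀ n, ∫_{Ω n} θ(z̄·mk g₁·z̄⁻¹) = ∫_{Ω n ∩ Ω R₀} …`.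
* **`hcancMixed_smoothIrrep`** — the same with `∀ s₀, hθ →` in front, for `θ = B v₁ (r.ρ · v₁)`, `r : SmoothIrrep G'`, Borel structures on `F`, `GL₃(F)` chosen inside the proof.
[HarishChandra1970, Part VII §2 Thm 20 p. 70, §3 pp. 71–73 (`Ω(γ)`)]; [Casselman1995, Thm. 5.3.1].

HONEST LABEL: HC_CM is proved only modulo the 7 printed citations (2 remaining named inputs: hLiu418 = `stmt-HodgeConjecture-24832`, h413 = `stmt-HodgeConjecture-24833`)
until rung 0 closes; this file is a count-neutral helper and closes no socket.

## References
* [HarishChandra1970] Harish-Chandra (notes by G. van Dijk), *Harmonic Analysis on Reductive p-adic Groups*, LNM 162 (1970), Part VII §2 Thm 20 p. 70, §3 pp. 71–73.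
* [Casselman1995] W. Casselman, *Introduction to the theory of admissible representations of `p`-adic reductive groups* (1995 notes), Thm. 5.3.1.
-/

set_option autoImplicit false
-- the mandated namespace repeats the single-problem summit's segment (`HodgeConjecture.HodgeConjecture`)
set_option linter.dupNamespace false

noncomputable section

open MeasureTheory MeasureTheory.Measure Set Filter Topology
open scoped MatrixGroups Pointwise WithZero
open Literature.NumberTheory.Automorphic Literature.NumberTheory.GaloisRepresentations Literature.NumberTheory.GaloisRepresentations.IsNonarchimedeanLocalField
open Summit.HodgeConjecture.HodgeConjecture.Cruxes.H413.K2E3GL3SupercuspOrbitalSliceCancellationNormalForm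

namespace Summit.HodgeConjecture.HodgeConjecture.Cruxes.H413.K2E3GL3SupercuspOrbitalSliceCancellationHM

/-! ## §1  Generic smooth supercuspidal `ρ` (the frame of ★ `ae_setIntegral_conj_eq_inter_of_hcancMixed`) -/

section Generic

variable {F : Type*} [Field F] [Valued F ℤᵐ⁰] [ValuativeRel F] [(Valued.v : Valuation F ℤᵐ⁰).Compatible] [IsNonarchimedeanLocalField F] [CharZero F]
  [MeasurableSpace F] [BorelSpace F] [MeasurableSpace (GL (Fin 3) F)] [BorelSpace (GL (Fin 3) F)]
  {ϖ : F} (hϖ : Valued.v ϖ = WithZero.exp (-1 : ℤ)) (hϖ0 : ϖ ≠ 0)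
  [((Subgroup.zpowers (Units.mk0 ϖ hϖ0)).map (Matrix.GeneralLinearGroup.scalar (Fin 3))).Normal]
  [MeasurableSpace (GL (Fin 3) F ⧸ (Subgroup.zpowers (Units.mk0 ϖ hϖ0)).map (Matrix.GeneralLinearGroup.scalar (Fin 3)))]
  [BorelSpace (GL (Fin 3) F ⧸ (Subgroup.zpowers (Units.mk0 ϖ hϖ0)).map (Matrix.GeneralLinearGroup.scalar (Fin 3)))]
  {V : Type*} [AddCommGroup V] [Module ℂ V] (ρ : Representation ℂ (GL (Fin 3) F ⧸ (Subgroup.zpowers (Units.mk0 ϖ hϖ0)).map (Matrix.GeneralLinearGroup.scalar (Fin 3))) V)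
  (hρ : ρ.IsSmooth) (hsc : ρ.IsSupercuspidal) {B : V →ₗ⋆[ℂ] V →ₗ[ℂ] ℂ}
  (hBinv : ∀ (g : GL (Fin 3) F ⧸ (Subgroup.zpowers (Units.mk0 ϖ hϖ0)).map (Matrix.GeneralLinearGroup.scalar (Fin 3))) (v w : V), B (ρ g v) (ρ g w) = B v w) (u u' : V)
  (Ω : CompactExhaustion (GL (Fin 3) F ⧸ (Subgroup.zpowers (Units.mk0 ϖ hϖ0)).map (Matrix.GeneralLinearGroup.scalar (Fin 3))))
  (hmem : ∀ (m : ℕ) (g : GL (Fin 3) F),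
    (QuotientGroup.mk g : GL (Fin 3) F ⧸ (Subgroup.zpowers (Units.mk0 ϖ hϖ0)).map (Matrix.GeneralLinearGroup.scalar (Fin 3))) ∈ Ω m ↔
      ∀ i j k l, Valued.v (ϖ ^ m * ((g : Matrix (Fin 3) (Fin 3) F) i j * ((g⁻¹ : GL (Fin 3) F) : Matrix (Fin 3) (Fin 3) F) k l)) ≤ 1)
  (hK : ∀ (m : ℕ) (k : GL (Fin 3) F), k ∈ glInt 3 F → ∀ x : GL (Fin 3) F ⧸ (Subgroup.zpowers (Units.mk0 ϖ hϖ0)).map (Matrix.GeneralLinearGroup.scalar (Fin 3)),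
    ((QuotientGroup.mk k : GL (Fin 3) F ⧸ _) * x ∈ Ω m ↔ x ∈ Ω m) ∧ (x * (QuotientGroup.mk k : GL (Fin 3) F ⧸ _) ∈ Ω m ↔ x ∈ Ω m))
  (μ' : Measure (GL (Fin 3) F ⧸ (Subgroup.zpowers (Units.mk0 ϖ hϖ0)).map (Matrix.GeneralLinearGroup.scalar (Fin 3)))) [μ'.IsHaarMeasure]

include hϖ hρ hsc hBinv hmem hK in
/-- **`HM` (generic frame), `A = 45`** — the binder of ★ `ae_setIntegral_conj_eq_inter_of_hcancMixed` VERBATIM: for every INTEGRAL `g₁ = y·[[e₀,e₁,0],[e₂,e₃,0],[0,0,e₄]]·y⁻¹` with the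
block `χ` irreducible, `ϖ^h g₁⁻¹` integral and `|disc χ_{g₁}| = q^{−L₀}` there is `R₀ ≤ 45·(s₀ + h + L₀ + 1)` (namely `45s₀ + 13L₀ + 1`) with
`∫_{Ω n} θ(z̄·mk g₁·z̄⁻¹) dμ' = ∫_{Ω n ∩ Ω R₀} …` for all `n` (★ FILE 4 `…_of_integral_mixed`). [cite: HarishChandra1970, Part VII §2 Thm 20 p. 70, §3 pp. 72–73] -/
theorem hcancMixed {s₀ : ℕ}
    (hθ : ∀ g : GL (Fin 3) F ⧸ (Subgroup.zpowers (Units.mk0 ϖ hϖ0)).map (Matrix.GeneralLinearGroup.scalar (Fin 3)), B u' (ρ g u) ≠ 0 → g ∈ Ω s₀) :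
    ∀ (g₁ y : GL (Fin 3) F) (e : Fin 5 → F) (h L₀ : ℕ),
      Irreducible ((!![e 0, e 1; e 2, e 3] : Matrix (Fin 2) (Fin 2) F)).charpoly →
      (g₁ : Matrix (Fin 3) (Fin 3) F) = (y : Matrix (Fin 3) (Fin 3) F) * !![e 0, e 1, 0; e 2, e 3, 0; 0, 0, e 4] * ((y⁻¹ : GL (Fin 3) F) : Matrix (Fin 3) (Fin 3) F) →
      (∀ i j, Valued.v ((g₁ : Matrix (Fin 3) (Fin 3) F) i j) ≤ 1) → (∀ i j, Valued.v (ϖ ^ h * ((g₁⁻¹ : GL (Fin 3) F) : Matrix (Fin 3) (Fin 3) F) i j) ≤ 1) →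
      Valued.v ((g₁ : Matrix (Fin 3) (Fin 3) F)).charpoly.discr = WithZero.exp (-(L₀ : ℤ)) →
      ∃ R₀ : ℕ, R₀ ≤ 45 * (s₀ + h + L₀ + 1) ∧ ∀ n : ℕ,
        ∫ z in Ω n, B u' (ρ (z * QuotientGroup.mk g₁ * z⁻¹) u) ∂μ' = ∫ z in Ω n ∩ Ω R₀, B u' (ρ (z * QuotientGroup.mk g₁ * z⁻¹) u) ∂μ' :=
  fun _ _ _ h L₀ hirr hg hint _ hL₀ =>
    ⟨45 * s₀ + 13 * L₀ + 1, by omega, fun n =>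
      setIntegral_conj_eq_setIntegral_inter_of_integral_mixed hϖ hϖ0 ρ hρ hsc hBinv u u' Ω hmem hK μ' hθ hirr hg hint hL₀ le_rfl n⟩

end Generic

/-! ## §2  `r : SmoothIrrep G'` (the frame of `nonEllEstimates_of_hcancMixed`: no measurable structure on `F`, `GL₃(F)`) -/

section Irrep

variable {F : Type*} [Field F] [Valued F ℤᵐ⁰] [ValuativeRel F] [(Valued.v : Valuation F ℤᵐ⁰).Compatible] [IsNonarchimedeanLocalField F] [CharZero F]
  {ϖ : F} (hϖ : Valued.v ϖ = WithZero.exp (-1 : ℤ)) (hϖ0 : ϖ ≠ 0)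
  [((Subgroup.zpowers (Units.mk0 ϖ hϖ0)).map (Matrix.GeneralLinearGroup.scalar (Fin 3))).Normal]
  [MeasurableSpace (GL (Fin 3) F ⧸ (Subgroup.zpowers (Units.mk0 ϖ hϖ0)).map (Matrix.GeneralLinearGroup.scalar (Fin 3)))]
  [BorelSpace (GL (Fin 3) F ⧸ (Subgroup.zpowers (Units.mk0 ϖ hϖ0)).map (Matrix.GeneralLinearGroup.scalar (Fin 3)))]
  (μ : Measure (GL (Fin 3) F ⧸ (Subgroup.zpowers (Units.mk0 ϖ hϖ0)).map (Matrix.GeneralLinearGroup.scalar (Fin 3)))) [μ.IsHaarMeasure]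
  (r : SmoothIrrep (GL (Fin 3) F ⧸ (Subgroup.zpowers (Units.mk0 ϖ hϖ0)).map (Matrix.GeneralLinearGroup.scalar (Fin 3)))) (hsc : r.ρ.IsSupercuspidal)
  (B : r.V →ₗ⋆[ℂ] r.V →ₗ[ℂ] ℂ)
  (hBinv : ∀ (g : GL (Fin 3) F ⧸ (Subgroup.zpowers (Units.mk0 ϖ hϖ0)).map (Matrix.GeneralLinearGroup.scalar (Fin 3))) (x y : r.V), B (r.ρ g x) (r.ρ g y) = B x y)
  (v₁ : r.V)
  (Ω : CompactExhaustion (GL (Fin 3) F ⧸ (Subgroup.zpowers (Units.mk0 ϖ hϖ0)).map (Matrix.GeneralLinearGroup.scalar (Fin 3))))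
  (hmem : ∀ (m : ℕ) (g : GL (Fin 3) F),
    (QuotientGroup.mk g : GL (Fin 3) F ⧸ (Subgroup.zpowers (Units.mk0 ϖ hϖ0)).map (Matrix.GeneralLinearGroup.scalar (Fin 3))) ∈ Ω m ↔
      ∀ i j k l, Valued.v (ϖ ^ m * ((g : Matrix (Fin 3) (Fin 3) F) i j * ((g⁻¹ : GL (Fin 3) F) : Matrix (Fin 3) (Fin 3) F) k l)) ≤ 1)
  (hK : ∀ (m : ℕ) (k : GL (Fin 3) F), k ∈ glInt 3 F → ∀ x : GL (Fin 3) F ⧸ (Subgroup.zpowers (Units.mk0 ϖ hϖ0)).map (Matrix.GeneralLinearGroup.scalar (Fin 3)),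
    ((QuotientGroup.mk k : GL (Fin 3) F ⧸ _) * x ∈ Ω m ↔ x ∈ Ω m) ∧ (x * (QuotientGroup.mk k : GL (Fin 3) F ⧸ _) ∈ Ω m ↔ x ∈ Ω m))

include hϖ hsc hBinv hmem hK in
/-- **`HM` (irrep frame), `A = 45`** — the binder of `nonEllEstimates_of_hcancMixed` VERBATIM for `θ = B v₁ (r.ρ · v₁)`, `r : SmoothIrrep G'` supercuspidal: for every support
height `s₀` of `θ` and every INTEGRAL mixed-normal-form `g₁` (`ϖ^h g₁⁻¹` integral, `|disc χ_{g₁}| = q^{−L₀}`) there is `R₀ ≤ 45·(s₀ + h + L₀ + 1)` with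
`∫_{Ω n} θ(z̄·mk g₁·z̄⁻¹) dμ = ∫_{Ω n ∩ Ω R₀} …` for all `n`.  The Borel structures on `F` and `GL₃(F)` that §1 needs are chosen inside the proof; the statement does not depend
on them. [cite: HarishChandra1970, Part VII §2 Thm 20 p. 70, §3 pp. 72–73] [cite: Casselman1995, Thm. 5.3.1] -/
theorem hcancMixed_smoothIrrep :
    ∀ s₀ : ℕ, (∀ g : GL (Fin 3) F ⧸ (Subgroup.zpowers (Units.mk0 ϖ hϖ0)).map (Matrix.GeneralLinearGroup.scalar (Fin 3)), B v₁ (r.ρ g v₁) ≠ 0 → g ∈ Ω s₀) →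
      ∀ (g₁ y : GL (Fin 3) F) (e : Fin 5 → F) (h L₀ : ℕ),
      Irreducible ((!![e 0, e 1; e 2, e 3] : Matrix (Fin 2) (Fin 2) F)).charpoly →
      (g₁ : Matrix (Fin 3) (Fin 3) F) = (y : Matrix (Fin 3) (Fin 3) F) * !![e 0, e 1, 0; e 2, e 3, 0; 0, 0, e 4] * ((y⁻¹ : GL (Fin 3) F) : Matrix (Fin 3) (Fin 3) F) →
      (∀ i j, Valued.v ((g₁ : Matrix (Fin 3) (Fin 3) F) i j) ≤ 1) → (∀ i j, Valued.v (ϖ ^ h * ((g₁⁻¹ : GL (Fin 3) F) : Matrix (Fin 3) (Fin 3) F) i j) ≤ 1) →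
      Valued.v ((g₁ : Matrix (Fin 3) (Fin 3) F)).charpoly.discr = WithZero.exp (-(L₀ : ℤ)) →
      ∃ R₀ : ℕ, R₀ ≤ 45 * (s₀ + h + L₀ + 1) ∧ ∀ n : ℕ,
        ∫ z in Ω n, B v₁ (r.ρ (z * QuotientGroup.mk g₁ * z⁻¹) v₁) ∂μ = ∫ z in Ω n ∩ Ω R₀, B v₁ (r.ρ (z * QuotientGroup.mk g₁ * z⁻¹) v₁) ∂μ := by
  intro s₀ hθ g₁ y e h L₀ hirr hg hint hinv hL₀
  letI : MeasurableSpace F := borel F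
  haveI : BorelSpace F := ⟨rfl⟩
  letI : MeasurableSpace (GL (Fin 3) F) := borel _
  haveI : BorelSpace (GL (Fin 3) F) := ⟨rfl⟩
  exact hcancMixed hϖ hϖ0 r.ρ r.isSmooth hsc hBinv v₁ v₁ Ω hmem hK μ hθ g₁ y e h L₀ hirr hg hint hinv hL₀

end Irrep

end Summit.HodgeConjecture.HodgeConjecture.Cruxes.H413.K2E3GL3SupercuspOrbitalSliceCancellationHM

end
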